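import Summits.QuantumFields.YangMills.Theorems.BalabanUVNodesN15KingModelBoxDeterminant
import Literature.Barriers.CriticalPhenomena.RigorousRGSmallParameterFlowExponent
import HarnessLib

/-!
# BalabanUVNodes ∕ N15 — THE KING-MODEL RUNG (PART Ϟ-d): KING's (3.93) ON HIS REGION `Ω` — THE CONTINUUM EFFECTIVE LAPLACIAN `Δ^{(∞)}_Ω = fold(Δ^{(∞)})` WITH FREE BOUNDARY
# CONDITIONS, `det Δ^{(∞)}_Ω = Π_{k∈Ω} Δ^{(∞)}(πk∕n)`, `ln N_∞(Ω)`, AND THE RATE `|ln N_K(Ω) − ln N_∞(Ω)| ≤ ½|Ω|·C′·L^{−2K}` WITH THE EXPLICIT `C′` OF PART Ε-o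
# (Track A, DAG node N15 = NE2; FAN-OUT v1.1 §N15 s3 «KING-MODEL RUNG»; King p.670 l.8–13; count-neutral)

HONEST FRAMING.  Count-neutral (cell `pub-ymgap`, seat `pub-ymgap-dag-n15-e` g41; `--supports stmt-QuantumFields-27366 --as helper` = K3⁸).
TEMPLATE LITERATURE: C. King, Commun. Math. Phys. **102** (1986) 649–677 [King1986]: Thm 3.4 (3.9) p.656 and (3.89)–(3.93) pp.668–669 (the normalisations `N_k` converge,
`|ln N_k − ln N_{k+n}| ≤ O(1)L^{−2k}|Ω|`-type rate via Lemma 4.3 (4.18) p.672), §4 p.670 l.8–13 (on `Ω`: free boundary conditions).  Parts Ε-o∕Ε-p (g40) proved (3.93) for the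
TORUS normalisations with the explicit constant `C′ = (a_∞⁻¹+m⁻²)·((8∕3)a²(a⁻¹+π²∕48+1∕3) + (4∕3)a)`; part Ϟ-c gave `det Δ^{(K)}_Ω = Π_{k∈Ω} effSym(k̂)` and (3.89) on `Ω`.
THIS FILE does (3.93) ON `Ω`: §1 `continuous_foldOp` (folding is continuous), `tendsto_foldOp`, `tendsto_matrix_apply`, `IsReflSymm.of_tendsto` (a limit of reflection-symmetric operators is reflection symmetric);
§2 ★ `isReflSymm_effLaplacianLim`, ★ `tendsto_foldOp_effLaplacian` (`Δ^{(K)}_Ω → Δ^{(∞)}_Ω` as matrices), `tendsto_det_foldOp_effLaplacian`, ★★★ **`det_foldOp_effLaplacianLim_eq_prod`**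
(`det Δ^{(∞)}_Ω = Π_{k∈Ω} effSymLim(πk∕n)` by uniqueness of limits), `det_foldOp_effLaplacianLim_pos`, ★★ `log_det_foldOp_effLaplacianLim`, `foldOp_effLaplacianLim_coercive`,
`foldOp_effLaplacianLim_transpose`, ★★ **`log_gaussNorm_foldOp_effLaplacianLim`** (`ln N_∞(Ω) = ½|Ω|ln 2π − ½Σ_{k∈Ω} ln Δ^{(∞)}(πk∕n)`); §3 `abs_log_effSym_sub_lim_le_dblBox` (the
per-momentum rate at the half-grid momenta, `log` being `δ_∞⁻¹`-Lipschitz on `[δ_∞,∞)`), ★★★ **`abs_log_det_foldOp_effLaplacian_sub_lim_le`** (`|ln det Δ^{(K)}_Ω − ln det Δ^{(∞)}_Ω|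
≤ |Ω|·C′·L^{−2K}`), ★★★ **`abs_log_gaussNorm_foldOp_effLaplacian_sub_lim_le`** (KING's (3.93) ON `Ω`: `|ln N_K(Ω) − ln N_∞(Ω)| ≤ ½|Ω|·C′·L^{−2K}`), ★★ per site
`abs_log_gaussNorm_foldOp_div_card_sub_lim_le`, ★★ two scales `abs_log_gaussNorm_foldOp_effLaplacian_two_scales` (`|ln N_K(Ω) − ln N_{K′}(Ω)| ≤ ½|Ω|C′(L^{−2K}+L^{−2K′})`),
★★ `tendsto_log_gaussNorm_foldOp_effLaplacian` (`ln N_K(Ω) → ln N_∞(Ω)`).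

PRIOR TREE ART (named, USED not restated): Ϟ-a∕Ϟ-b∕Ϟ-c (`det_eq_prod_of_boxWave_eigen`, `det_foldOp_effLaplacian_eq_prod`, `log_det_foldOp_effLaplacian`,
`log_gaussNorm_foldOp_effLaplacian`), Ν-f∕Ν-h (`foldOp`, `IsReflSymm`, `isReflSymm_effLaplacian`, `foldOp_coercive`, `foldOp_transpose_eq`), Ϡ-g∕Ε-o∕Ε-p and the continuum-symbol
files (`effLaplacianLim`, `tendsto_effLaplacian`, `effLaplacianLim_transpose_eq`, `coercive_effLaplacianLim`, `effSymLim`, `tendsto_effSym_pow`, `effSym_eq_DeltaEff`,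
`DeltaEff_ge_unif`, `effSymLim_ge_unif`, `abs_DeltaEff_sub_lim_le`, `aInf_pos`, `log_gaussNorm_eq`, `det_pos_of_coercive`), `Literature.Barriers.CriticalPhenomena.LongRangePhi4`
(`abs_log_sub_log_le_div` — `log` is `a⁻¹`-Lipschitz on `[a,∞)`).  NOT Bałaban's covariant objects; NOT a node discharge (N15 is booked through n15-a's knit, untouched); nothing
continuum-YM ∕ `ℝ⁴` ∕ OS ∕ Clay.  0 `sorry`; 0 `def`.

HONEST SCOPE.  King's `A = 0` free model on `Ω = Π_μ{0,…,n_μ−1}` (blocks), `L` odd `≥ 2`, `a, m² > 0`, `K ≥ 1`, King's coupling `a_K = aK a L K`, `c = L^{2K}`; the rate is the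
TORUS rate of part Ε-o read at the half-grid momenta (no new estimate).  The thermodynamic limit of `|Ω|⁻¹ln det` is NOT here (part Ϟ-e).  Locators: [King1986] Thm 3.4 (3.9)
p.656, (3.89)–(3.93) pp.668–669, Lemma 4.3 (4.18) p.672, (4.5) p.670, §4 p.670 l.8–13.
-/

noncomputable section

open scoped BigOperators Topology
open Finset Filter Matrix

namespace Summit.QuantumFields.YangMills.BalabanUVNodes.N15KingModelRung.TorusSpectral

open Literature.MathematicalPhysics.QuantumFieldTheory.Balaban1983to89.B5Prop11Plancherel (Tor sOf)
open Literature.MathematicalPhysics.QuantumFieldTheory.Balaban1983to89.QGQInverse (Coercive)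
open Literature.MathematicalPhysics.QuantumFieldTheory.King1986 (aK aK_pos DeltaEff)
open Literature.MathematicalPhysics.QuantumFieldTheory.King1986.Torus
open Literature.Barriers.CriticalPhenomena.LongRangePhi4 (abs_log_sub_log_le_div)
open Summit.QuantumFields.YangMills.BalabanUVNodes.N15KingModelRung.FreeField (gaussNorm)

variable {d : ℕ}

/-! ## §1 Folding is continuous; reflection symmetry passes to limits -/

section Folding

variable (n : Fin (d + 1) → ℕ) [hn : ∀ μ, NeZero (n μ)]

omit hn in
/-- folding `A ↦ fold(A)` is continuous (each entry of `fold(A)` is a finite sum of entries of `A`). [folklore] -/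
theorem continuous_foldOp : Continuous (foldOp n : Matrix (Tor (dblPer n)) (Tor (dblPer n)) ℝ → Matrix (KingBox n) (KingBox n) ℝ) := by
  refine continuous_pi fun s => continuous_pi fun t => ?_
  simp only [foldOp]
  exact continuous_finsetSum _ fun S _ => (continuous_apply _).comp (continuous_apply _)

omit hn in
/-- `fold(A_K) → fold(A)` whenever `A_K → A` as matrices. [folklore] -/
theorem tendsto_foldOp {A : ℕ → Matrix (Tor (dblPer n)) (Tor (dblPer n)) ℝ} {Alim : Matrix (Tor (dblPer n)) (Tor (dblPer n)) ℝ}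
    (h : Tendsto A atTop (𝓝 Alim)) : Tendsto (fun K => foldOp n (A K)) atTop (𝓝 (foldOp n Alim)) :=
  ((continuous_foldOp n).tendsto Alim).comp h

omit hn in
/-- entrywise convergence from matrix convergence. [folklore] -/
theorem tendsto_matrix_apply {A : ℕ → Matrix (Tor (dblPer n)) (Tor (dblPer n)) ℝ} {Alim : Matrix (Tor (dblPer n)) (Tor (dblPer n)) ℝ}
    (h : Tendsto A atTop (𝓝 Alim)) (x y : Tor (dblPer n)) : Tendsto (fun K => A K x y) atTop (𝓝 (Alim x y)) :=
  (tendsto_pi_nhds.mp (tendsto_pi_nhds.mp h x)) y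

omit hn in
/-- a limit of reflection-symmetric operators is reflection symmetric. [folklore] -/
theorem IsReflSymm.of_tendsto {A : ℕ → Matrix (Tor (dblPer n)) (Tor (dblPer n)) ℝ} {Alim : Matrix (Tor (dblPer n)) (Tor (dblPer n)) ℝ}
    (h : Tendsto A atTop (𝓝 Alim)) (hA : ∀ K, IsReflSymm n (A K)) : IsReflSymm n Alim := by
  intro S x y
  have h1 := tendsto_matrix_apply n h (torReflS (dblPer n) S x) (torReflS (dblPer n) S y)
  have h2 := tendsto_matrix_apply n h x y
  exact tendsto_nhds_unique (h1.congr fun K => hA K S x y) h2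

end Folding

/-! ## §2 King's continuum effective Laplacian on `Ω` with free boundary conditions -/

section Continuum

variable (L : ℕ) (n : Fin (d + 1) → ℕ) [hn : ∀ μ, NeZero (n μ)]

/-- ★ `Δ^{(∞)}` is reflection symmetric (as the limit of the reflection-symmetric `Δ^{(K)}`). [cite: King1986, (2.14) p.653, Thm 3.4 (3.9) p.656] -/
theorem isReflSymm_effLaplacianLim (hLodd : Odd L) (hL : 2 ≤ L) {a m2 : ℝ} (ha : 0 < a) (hm : 0 < m2) :
    IsReflSymm n (Matrix.of fun b b' => effLaplacianLim L (dblPer n) a m2 b b') := by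
  haveI : NeZero L := ⟨by omega⟩
  exact IsReflSymm.of_tendsto n (tendsto_effLaplacian_matrix L (dblPer n) hLodd hL ha hm) fun K => isReflSymm_effLaplacian (L ^ K) n _ _ m2

/-- ★ **`Δ^{(K)}_Ω → Δ^{(∞)}_Ω` as matrices** (folding is continuous). [cite: King1986, Thm 3.4 (3.9) p.656, §4 p.670] -/
theorem tendsto_foldOp_effLaplacian (hLodd : Odd L) (hL : 2 ≤ L) {a m2 : ℝ} (ha : 0 < a) (hm : 0 < m2) :
    haveI : NeZero L := ⟨by omega⟩
    Tendsto (fun K : ℕ => foldOp n (effLaplacian (L ^ K) (dblPer n) (aK a L K) (((L ^ K : ℕ) : ℝ) ^ 2) m2)) atTop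
      (𝓝 (foldOp n (Matrix.of fun b b' => effLaplacianLim L (dblPer n) a m2 b b'))) := by
  haveI : NeZero L := ⟨by omega⟩
  exact tendsto_foldOp n (tendsto_effLaplacian_matrix L (dblPer n) hLodd hL ha hm)

/-- `det Δ^{(K)}_Ω → det Δ^{(∞)}_Ω`. [cite: King1986, (3.89) p.668, Thm 3.4 (3.9) p.656] -/
theorem tendsto_det_foldOp_effLaplacian (hLodd : Odd L) (hL : 2 ≤ L) {a m2 : ℝ} (ha : 0 < a) (hm : 0 < m2) :
    haveI : NeZero L := ⟨by omega⟩
    Tendsto (fun K : ℕ => (foldOp n (effLaplacian (L ^ K) (dblPer n) (aK a L K) (((L ^ K : ℕ) : ℝ) ^ 2) m2)).det) atTop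
      (𝓝 (foldOp n (Matrix.of fun b b' => effLaplacianLim L (dblPer n) a m2 b b')).det) :=
  ((continuous_id.matrix_det).tendsto _).comp (tendsto_foldOp_effLaplacian L n hLodd hL ha hm)

/-- ★★★ **THE DETERMINANT OF KING's CONTINUUM EFFECTIVE LAPLACIAN ON `Ω`**: `det Δ^{(∞)}_Ω = Π_{k∈Ω} Δ^{(∞)}(πk∕n)` (`L` odd `≥ 2`, `a, m² > 0`; uniqueness of limits from Ϟ-c's
`det Δ^{(K)}_Ω = Π_k effSym_K(k̂)` and the symbol limits of part Ϡ). [cite: King1986, (3.89) p.668, (4.5) p.670, Thm 3.4 (3.9) p.656, §4 p.670 l.8–13] -/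
theorem det_foldOp_effLaplacianLim_eq_prod (hLodd : Odd L) (hL : 2 ≤ L) {a m2 : ℝ} (ha : 0 < a) (hm : 0 < m2) :
    (foldOp n (Matrix.of fun b b' => effLaplacianLim L (dblPer n) a m2 b b')).det = ∏ k : KingBox n, effSymLim a L m2 (sOf (dblPer n) (dblBox n k)) := by
  haveI : NeZero L := ⟨by omega⟩
  have hL1 : (1 : ℝ) < L := by exact_mod_cast (show 1 < L by omega)
  have hprod : Tendsto (fun K : ℕ => ∏ k : KingBox n, effSym (L ^ K) (dblPer n) (aK a L K) (((L ^ K : ℕ) : ℝ) ^ 2) m2 (dblBox n k)) atTop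
      (𝓝 (∏ k : KingBox n, effSymLim a L m2 (sOf (dblPer n) (dblBox n k)))) :=
    tendsto_finsetProd _ fun k _ => tendsto_effSym_pow L (dblPer n) hLodd hL ha hm (dblBox n k)
  refine tendsto_nhds_unique (tendsto_det_foldOp_effLaplacian L n hLodd hL ha hm) (hprod.congr' ?_)
  filter_upwards [eventually_ge_atTop 1] with K hK
  exact (det_foldOp_effLaplacian_eq_prod (L ^ K) n (aK_pos ha hL1 hK).le (by positivity) hm).symm

/-- `det Δ^{(∞)}_Ω > 0`. [cite: King1986, (3.89) p.668] -/
theorem det_foldOp_effLaplacianLim_pos (hLodd : Odd L) (hL : 2 ≤ L) {a m2 : ℝ} (ha : 0 < a) (hm : 0 < m2) :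
    0 < (foldOp n (Matrix.of fun b b' => effLaplacianLim L (dblPer n) a m2 b b')).det := by
  rw [det_foldOp_effLaplacianLim_eq_prod L n hLodd hL ha hm]
  exact Finset.prod_pos fun k _ => lt_of_lt_of_le (by have := aInf_pos ha (by exact_mod_cast (show 1 < L by omega) : (1 : ℝ) < L); positivity)
    (effSymLim_ge_unif L (dblPer n) hLodd hL ha hm (dblBox n k))

/-- ★★ `ln det Δ^{(∞)}_Ω = Σ_{k∈Ω} ln Δ^{(∞)}(πk∕n)`. [cite: King1986, (3.89) p.668, (4.5) p.670] -/
theorem log_det_foldOp_effLaplacianLim (hLodd : Odd L) (hL : 2 ≤ L) {a m2 : ℝ} (ha : 0 < a) (hm : 0 < m2) :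
    Real.log (foldOp n (Matrix.of fun b b' => effLaplacianLim L (dblPer n) a m2 b b')).det
      = ∑ k : KingBox n, Real.log (effSymLim a L m2 (sOf (dblPer n) (dblBox n k))) := by
  rw [det_foldOp_effLaplacianLim_eq_prod L n hLodd hL ha hm, Real.log_prod]
  intro k _
  exact (lt_of_lt_of_le (by have := aInf_pos ha (by exact_mod_cast (show 1 < L by omega) : (1 : ℝ) < L); positivity)
    (effSymLim_ge_unif L (dblPer n) hLodd hL ha hm (dblBox n k))).ne'

/-- `Δ^{(∞)}_Ω` is coercive with the torus constant of part Ϡ. [cite: King1986, (4.8) p.671, §4 p.670] -/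
theorem foldOp_effLaplacianLim_coercive (hLodd : Odd L) (hL : 2 ≤ L) {a m2 : ℝ} (ha : 0 < a) (hm : 0 < m2) :
    Coercive (foldOp n (Matrix.of fun b b' => effLaplacianLim L (dblPer n) a m2 b b'))
      (aInf a L / (1 + aInf a L * ((Real.pi / 2) ^ (2 * (d + 1)) * Real.pi ^ (d + 1) / m2 * (1 + 4 / Real.pi) ^ (d + 1)))) :=
  foldOp_coercive n (isReflSymm_effLaplacianLim L n hLodd hL ha hm) (coercive_effLaplacianLim L (dblPer n) hLodd hL ha hm)

/-- `Δ^{(∞)}_Ω` is symmetric. [cite: King1986, (2.14) p.653] -/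
theorem foldOp_effLaplacianLim_transpose (hLodd : Odd L) (hL : 2 ≤ L) {a m2 : ℝ} (ha : 0 < a) (hm : 0 < m2) :
    (foldOp n (Matrix.of fun b b' => effLaplacianLim L (dblPer n) a m2 b b'))ᵀ = foldOp n (Matrix.of fun b b' => effLaplacianLim L (dblPer n) a m2 b b') :=
  foldOp_transpose_eq n (isReflSymm_effLaplacianLim L n hLodd hL ha hm) (effLaplacianLim_transpose_eq L (dblPer n) a m2)

/-- ★★ **THE CONTINUUM NORMALISATION ON `Ω`**: `ln N_∞(Ω) := ln 𝒩(Δ^{(∞)}_Ω) = ½|Ω|·ln 2π − ½Σ_{k∈Ω} ln Δ^{(∞)}(πk∕n)`. [cite: King1986, (3.89) p.668, Thm 3.4 (3.9) p.656, §4 p.670] -/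
theorem log_gaussNorm_foldOp_effLaplacianLim (hLodd : Odd L) (hL : 2 ≤ L) {a m2 : ℝ} (ha : 0 < a) (hm : 0 < m2) :
    Real.log (gaussNorm (foldOp n (Matrix.of fun b b' => effLaplacianLim L (dblPer n) a m2 b b')))
      = (Fintype.card (KingBox n) : ℝ) / 2 * Real.log (2 * Real.pi) - 1 / 2 * ∑ k : KingBox n, Real.log (effSymLim a L m2 (sOf (dblPer n) (dblBox n k))) := by
  have hL1 : (1 : ℝ) < L := by exact_mod_cast (show 1 < L by omega)
  have hγ : 0 < aInf a L / (1 + aInf a L * ((Real.pi / 2) ^ (2 * (d + 1)) * Real.pi ^ (d + 1) / m2 * (1 + 4 / Real.pi) ^ (d + 1))) := by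
    have := aInf_pos ha hL1
    positivity
  rw [log_gaussNorm_eq (foldOp_effLaplacianLim_transpose L n hLodd hL ha hm) hγ (foldOp_effLaplacianLim_coercive L n hLodd hL ha hm),
    log_det_foldOp_effLaplacianLim L n hLodd hL ha hm]

end Continuum

/-! ## §3 King's (3.93) on `Ω`: the `η`-rate of the normalisations with free boundary conditions -/

section Rate

variable (L : ℕ) (n : Fin (d + 1) → ℕ) [hn : ∀ μ, NeZero (n μ)]

/-- the per-momentum rate at a half-grid momentum: `|ln effSym_K(k̂) − ln Δ^{(∞)}(πk∕n)| ≤ C′·L^{−2K}` (Lemma 4.3's symbol rate of part Ϡ + `log` is `δ_∞⁻¹`-Lipschitz on `[δ_∞, ∞)`).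
[cite: King1986, Lemma 4.3 (4.18) p.672, (4.5) p.670, (3.93) p.669] -/
theorem abs_log_effSym_sub_lim_le_dblBox (hLodd : Odd L) (hL : 2 ≤ L) {a m2 : ℝ} (ha : 0 < a) (hm : 0 < m2) {K : ℕ} (hK : 1 ≤ K) (k : KingBox n) :
    haveI : NeZero L := ⟨by omega⟩
    |Real.log (effSym (L ^ K) (dblPer n) (aK a L K) (((L ^ K : ℕ) : ℝ) ^ 2) m2 (dblBox n k)) - Real.log (effSymLim a L m2 (sOf (dblPer n) (dblBox n k)))|
      ≤ ((aInf a L)⁻¹ + m2⁻¹) * (8 / 3 * (a ^ 2 * (a⁻¹ + Real.pi ^ 2 / 48 + 1 / 3)) + 4 / 3 * a) * ((L : ℝ) ^ (2 * K))⁻¹ := by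
  haveI : NeZero L := ⟨by omega⟩
  have hL1 : (1 : ℝ) < L := by exact_mod_cast (show 1 < L by omega)
  have haK := aK_pos ha hL1 hK
  have haI := aInf_pos ha hL1
  have hLK : 1 ≤ L ^ K := Nat.one_le_pow K L (by omega)
  have hδ : 0 < ((aInf a L)⁻¹ + m2⁻¹)⁻¹ := by positivity
  rw [effSym_eq_DeltaEff (L ^ K) (dblPer n) hLK haK hm (dblBox n k)]
  have hx := DeltaEff_ge_unif L (dblPer n) hL ha hm hK (dblBox n k)
  have hy := effSymLim_ge_unif L (dblPer n) hLodd hL ha hm (dblBox n k)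
  have hr := abs_DeltaEff_sub_lim_le L (dblPer n) hLodd hL ha hm hK (dblBox n k)
  calc _ ≤ |DeltaEff (aK a L K) (L ^ K) m2 (sOf (dblPer n) (dblBox n k)) - effSymLim a L m2 (sOf (dblPer n) (dblBox n k))| / ((aInf a L)⁻¹ + m2⁻¹)⁻¹ :=
        abs_log_sub_log_le_div hδ hx hy
    _ ≤ (8 / 3 * (a ^ 2 * (a⁻¹ + Real.pi ^ 2 / 48 + 1 / 3)) + 4 / 3 * a) * ((L : ℝ) ^ (2 * K))⁻¹ / ((aInf a L)⁻¹ + m2⁻¹)⁻¹ := div_le_div_of_nonneg_right hr hδ.le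
    _ = _ := by rw [div_eq_mul_inv, inv_inv]; ring

/-- ★★★ **THE `η`-RATE OF `ln det Δ^{(K)}_Ω`**: `|ln det Δ^{(K)}_Ω − ln det Δ^{(∞)}_Ω| ≤ |Ω|·C′·L^{−2K}`, `C′ = (a_∞⁻¹+m⁻²)((8∕3)a²(a⁻¹+π²∕48+1∕3) + (4∕3)a)` — the torus rate of part Ε-o
read on `Ω` with free boundary conditions. [cite: King1986, (3.93) p.669, (3.89) p.668, Lemma 4.3 (4.18) p.672, §4 p.670 l.8–13] -/
theorem abs_log_det_foldOp_effLaplacian_sub_lim_le (hLodd : Odd L) (hL : 2 ≤ L) {a m2 : ℝ} (ha : 0 < a) (hm : 0 < m2) {K : ℕ} (hK : 1 ≤ K) :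
    haveI : NeZero L := ⟨by omega⟩
    |Real.log (foldOp n (effLaplacian (L ^ K) (dblPer n) (aK a L K) (((L ^ K : ℕ) : ℝ) ^ 2) m2)).det
        - Real.log (foldOp n (Matrix.of fun b b' => effLaplacianLim L (dblPer n) a m2 b b')).det|
      ≤ (Fintype.card (KingBox n) : ℝ) * (((aInf a L)⁻¹ + m2⁻¹) * (8 / 3 * (a ^ 2 * (a⁻¹ + Real.pi ^ 2 / 48 + 1 / 3)) + 4 / 3 * a))
        * ((L : ℝ) ^ (2 * K))⁻¹ := by
  haveI : NeZero L := ⟨by omega⟩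
  have hL1 : (1 : ℝ) < L := by exact_mod_cast (show 1 < L by omega)
  have haK := aK_pos ha hL1 hK
  rw [log_det_foldOp_effLaplacian (L ^ K) n haK (by positivity) hm, log_det_foldOp_effLaplacianLim L n hLodd hL ha hm, ← Finset.sum_sub_distrib]
  refine (Finset.abs_sum_le_sum_abs _ _).trans ?_
  calc ∑ k : KingBox n, |Real.log (effSym (L ^ K) (dblPer n) (aK a L K) (((L ^ K : ℕ) : ℝ) ^ 2) m2 (dblBox n k)) - Real.log (effSymLim a L m2 (sOf (dblPer n) (dblBox n k)))|
      ≤ ∑ _k : KingBox n, ((aInf a L)⁻¹ + m2⁻¹) * (8 / 3 * (a ^ 2 * (a⁻¹ + Real.pi ^ 2 / 48 + 1 / 3)) + 4 / 3 * a) * ((L : ℝ) ^ (2 * K))⁻¹ :=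
        Finset.sum_le_sum fun k _ => abs_log_effSym_sub_lim_le_dblBox L n hLodd hL ha hm hK k
    _ = _ := by rw [Finset.sum_const, Finset.card_univ, nsmul_eq_mul]; ring

/-- ★★★ **KING's (3.93) ON `Ω` — THE RATE OF THE NORMALISATIONS WITH FREE BOUNDARY CONDITIONS**: for `L` odd `≥ 2`, `a, m² > 0`, `K ≥ 1` and every box of blocks,
`|ln N_K(Ω) − ln N_∞(Ω)| = ½|ln det Δ^{(K)}_Ω − ln det Δ^{(∞)}_Ω| ≤ ½|Ω|·C′·L^{−2K}` — extensive, rate `η² = L^{−2K}`, the SAME constant as on the torus (part Ε-p).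
[cite: King1986, (3.93) p.669, (3.89) p.668, Thm 3.4 (3.9) p.656, Lemma 4.3 (4.18) p.672, §4 p.670 l.8–13] -/
theorem abs_log_gaussNorm_foldOp_effLaplacian_sub_lim_le (hLodd : Odd L) (hL : 2 ≤ L) {a m2 : ℝ} (ha : 0 < a) (hm : 0 < m2) {K : ℕ} (hK : 1 ≤ K) :
    haveI : NeZero L := ⟨by omega⟩
    |Real.log (gaussNorm (foldOp n (effLaplacian (L ^ K) (dblPer n) (aK a L K) (((L ^ K : ℕ) : ℝ) ^ 2) m2)))
        - Real.log (gaussNorm (foldOp n (Matrix.of fun b b' => effLaplacianLim L (dblPer n) a m2 b b')))|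
      ≤ 1 / 2 * ((Fintype.card (KingBox n) : ℝ) * (((aInf a L)⁻¹ + m2⁻¹) * (8 / 3 * (a ^ 2 * (a⁻¹ + Real.pi ^ 2 / 48 + 1 / 3)) + 4 / 3 * a))
        * ((L : ℝ) ^ (2 * K))⁻¹) := by
  haveI : NeZero L := ⟨by omega⟩
  have hL1 : (1 : ℝ) < L := by exact_mod_cast (show 1 < L by omega)
  have haK := aK_pos ha hL1 hK
  rw [log_gaussNorm_foldOp_effLaplacian (L ^ K) n haK (by positivity) hm, log_gaussNorm_foldOp_effLaplacianLim L n hLodd hL ha hm,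
    ← log_det_foldOp_effLaplacian (L ^ K) n haK (by positivity) hm, ← log_det_foldOp_effLaplacianLim L n hLodd hL ha hm]
  have h := abs_log_det_foldOp_effLaplacian_sub_lim_le L n hLodd hL ha hm hK
  rw [show ∀ A B C : ℝ, (A - 1 / 2 * B) - (A - 1 / 2 * C) = -(1 / 2) * (B - C) from fun A B C => by ring, abs_mul, abs_neg,
    abs_of_pos (by norm_num : (0 : ℝ) < 1 / 2)]
  exact mul_le_mul_of_nonneg_left h (by norm_num)

/-- ★★ **PER SITE**: `| |Ω|⁻¹ln N_K(Ω) − |Ω|⁻¹ln N_∞(Ω) | ≤ ½·C′·L^{−2K}`, uniformly in the box. [cite: King1986, (3.93) p.669, (3.89) p.668] -/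
theorem abs_log_gaussNorm_foldOp_div_card_sub_lim_le (hLodd : Odd L) (hL : 2 ≤ L) {a m2 : ℝ} (ha : 0 < a) (hm : 0 < m2) {K : ℕ} (hK : 1 ≤ K) :
    haveI : NeZero L := ⟨by omega⟩
    |(Fintype.card (KingBox n) : ℝ)⁻¹ * Real.log (gaussNorm (foldOp n (effLaplacian (L ^ K) (dblPer n) (aK a L K) (((L ^ K : ℕ) : ℝ) ^ 2) m2)))
        - (Fintype.card (KingBox n) : ℝ)⁻¹ * Real.log (gaussNorm (foldOp n (Matrix.of fun b b' => effLaplacianLim L (dblPer n) a m2 b b')))|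
      ≤ 1 / 2 * (((aInf a L)⁻¹ + m2⁻¹) * (8 / 3 * (a ^ 2 * (a⁻¹ + Real.pi ^ 2 / 48 + 1 / 3)) + 4 / 3 * a)) * ((L : ℝ) ^ (2 * K))⁻¹ := by
  haveI : NeZero L := ⟨by omega⟩
  have hcard : (0 : ℝ) < Fintype.card (KingBox n) := by exact_mod_cast Fintype.card_pos
  have h := abs_log_gaussNorm_foldOp_effLaplacian_sub_lim_le L n hLodd hL ha hm hK
  rw [← mul_sub, abs_mul, abs_inv, abs_of_pos hcard]
  rw [inv_mul_le_iff₀ hcard]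
  calc _ ≤ _ := h
    _ = _ := by ring

/-- ★★ **TWO SCALES** (King's printed form of (3.93): `|ln N_K(Ω) − ln N_{K′}(Ω)| ≤ ½|Ω|·C′·(L^{−2K} + L^{−2K′})`). [cite: King1986, (3.93) p.669] -/
theorem abs_log_gaussNorm_foldOp_effLaplacian_two_scales (hLodd : Odd L) (hL : 2 ≤ L) {a m2 : ℝ} (ha : 0 < a) (hm : 0 < m2) {K K' : ℕ} (hK : 1 ≤ K) (hK' : 1 ≤ K') :
    haveI : NeZero L := ⟨by omega⟩
    |Real.log (gaussNorm (foldOp n (effLaplacian (L ^ K) (dblPer n) (aK a L K) (((L ^ K : ℕ) : ℝ) ^ 2) m2)))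
        - Real.log (gaussNorm (foldOp n (effLaplacian (L ^ K') (dblPer n) (aK a L K') (((L ^ K' : ℕ) : ℝ) ^ 2) m2)))|
      ≤ 1 / 2 * ((Fintype.card (KingBox n) : ℝ) * (((aInf a L)⁻¹ + m2⁻¹) * (8 / 3 * (a ^ 2 * (a⁻¹ + Real.pi ^ 2 / 48 + 1 / 3)) + 4 / 3 * a)))
        * (((L : ℝ) ^ (2 * K))⁻¹ + ((L : ℝ) ^ (2 * K'))⁻¹) := by
  haveI : NeZero L := ⟨by omega⟩
  have h1 := abs_log_gaussNorm_foldOp_effLaplacian_sub_lim_le L n hLodd hL ha hm hK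
  have h2 := abs_log_gaussNorm_foldOp_effLaplacian_sub_lim_le L n hLodd hL ha hm hK'
  calc _ ≤ |Real.log (gaussNorm (foldOp n (effLaplacian (L ^ K) (dblPer n) (aK a L K) (((L ^ K : ℕ) : ℝ) ^ 2) m2)))
            - Real.log (gaussNorm (foldOp n (Matrix.of fun b b' => effLaplacianLim L (dblPer n) a m2 b b')))|
          + |Real.log (gaussNorm (foldOp n (effLaplacian (L ^ K') (dblPer n) (aK a L K') (((L ^ K' : ℕ) : ℝ) ^ 2) m2)))
            - Real.log (gaussNorm (foldOp n (Matrix.of fun b b' => effLaplacianLim L (dblPer n) a m2 b b')))| := by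
        rw [abs_sub_comm (Real.log (gaussNorm (foldOp n (effLaplacian (L ^ K') (dblPer n) _ _ m2))))]
        exact abs_sub_le _ _ _
    _ ≤ _ := by nlinarith [h1, h2]

/-- ★★ `ln N_K(Ω) → ln N_∞(Ω)`. [cite: King1986, Thm 3.4 (3.9) p.656, (3.93) p.669] -/
theorem tendsto_log_gaussNorm_foldOp_effLaplacian (hLodd : Odd L) (hL : 2 ≤ L) {a m2 : ℝ} (ha : 0 < a) (hm : 0 < m2) :
    haveI : NeZero L := ⟨by omega⟩
    Tendsto (fun K : ℕ => Real.log (gaussNorm (foldOp n (effLaplacian (L ^ K) (dblPer n) (aK a L K) (((L ^ K : ℕ) : ℝ) ^ 2) m2)))) atTop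
      (𝓝 (Real.log (gaussNorm (foldOp n (Matrix.of fun b b' => effLaplacianLim L (dblPer n) a m2 b b'))))) := by
  haveI : NeZero L := ⟨by omega⟩
  have hL1 : (1 : ℝ) < L := by exact_mod_cast (show 1 < L by omega)
  set C : ℝ := 1 / 2 * ((Fintype.card (KingBox n) : ℝ) * (((aInf a L)⁻¹ + m2⁻¹) * (8 / 3 * (a ^ 2 * (a⁻¹ + Real.pi ^ 2 / 48 + 1 / 3)) + 4 / 3 * a))) with hC
  have hgeo : Tendsto (fun K : ℕ => C * ((L : ℝ) ^ (2 * K))⁻¹) atTop (𝓝 0) := by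
    have hq : Tendsto (fun K : ℕ => ((L : ℝ) ^ (2 * K))⁻¹) atTop (𝓝 0) := by
      have h0 : Tendsto (fun K : ℕ => (((L : ℝ) ^ 2)⁻¹) ^ K) atTop (𝓝 0) :=
        tendsto_pow_atTop_nhds_zero_of_lt_one (by positivity) (inv_lt_one_of_one_lt₀ (by nlinarith))
      refine h0.congr fun K => ?_
      rw [inv_pow, pow_mul]
    have := hq.const_mul C
    rw [mul_zero] at this
    exact this
  refine tendsto_sub_nhds_zero_iff.mp (squeeze_zero_norm' ?_ hgeo)
  filter_upwards [eventually_ge_atTop 1] with K hK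
  rw [Real.norm_eq_abs, hC, ← mul_assoc]
  have h := abs_log_gaussNorm_foldOp_effLaplacian_sub_lim_le L n hLodd hL ha hm hK
  calc _ ≤ _ := h
    _ = _ := by ring

end Rate

end Summit.QuantumFields.YangMills.BalabanUVNodes.N15KingModelRung.TorusSpectral

end
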